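import Summits.BirchSwinnertonDyer.Rank1Residual.Additive.SpecialJOrdinary
import Literature.NumberTheory.EllipticCurves.SerreOpenImageOrdinaryReductionProofs
import Literature.NumberTheory.EllipticCurves.VariableChangePoints
import Mathlib.AlgebraicGeometry.EllipticCurve.IsomOfJ
import Mathlib.AlgebraicGeometry.EllipticCurve.ModelsWithJ
import HarnessLib

/-!
# T-ROL-G F-B: the ORDINARY POINT of a good model whose reduction has `j̃ ∈ {0, 1728}` —
# semistability defects `e ∈ {3, 4, 6}` at `p ≡ 1 (mod e)`, `p ≥ 5` (team n1011, row T-ROL-G; seat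
# p05 GEN 5; lead R5-57; referee-1 ACK-1 GEN 16)

HONEST FRAMING (cell `b2b-bsdres`, run/shared/lean/b2b/bsd-rank1-residual/, verbatim in every
file): the goal of the cell is to DELETE the COMBINATION-SHAPED residual classes of the
Birch–Swinnerton-Dyer formula for ALL analytic-rank `≤ 1` elliptic curves over `ℚ` — "full BSD
formula for every rank `≤ 1` curve in class `C`" assembled STRICTLY from published theorems — so
that the rank-`≤ 1` remainder becomes exactly the CONSTRUCTION-SHAPED classes, which are TYPED
(missing-input `Prop`s), NOT attempted. This is not "finishing BSD". Team n1011 (N10/N11): research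
route on the CONSTRUCTION-SHAPED classes X3♯(G-ord)/X4♯(G-ord); prove what is provable now; no
claim beyond stated classes; census output = EVIDENCE, never a Literature fact; RESIDUAL-MAP marks
UNCHANGED; nothing is booked by this file. TOOL theorems only: NO definition, NO named fact, NO
conjecture node.

## What and why

Row T-ROL-G builds the ramified ordinary line of an X4♯(G-ord)/X3♯(G-ord) row with semistability
defect `e ∈ {3, 4, 6}` from a GOOD MODEL `W₀` over the valuation ring `𝒪_w` of `K̄_v` (files
`GoodModelReductionKernel/Datum/Line`). Those files take the tree's ORDINARY hypothesis of
`OrdinaryReductionKernelTorsionProofs` §5 as an input: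
`hord : ∃ P : W₀(K̄_v), p • P = 0 ∧ red_{W₀} P ≠ Õ` ("some `p`-torsion point has non-zero
reduction"). On the `e ∈ {3, 4, 6}` rows the reduced curve has `j̃ = 0` (`e ∈ {3, 6}`: `ord_p j > 0`)
or `j̃ = 1728` (`e = 4`: `ord_p (j − 1728) > 0`) and `p ≡ 1 (mod 3)` resp. `(mod 4)` (additive-p2's
`SubGordHigherOrdinary`, `SpecialJDeuring`); this file DISCHARGES `hord` there, for ANY good model
over ANY valuation ring (residue characteristic `p`) of an algebraically closed field:

* §1 (over an algebraically closed field `k` of characteristic `p`, `V/k` elliptic)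
  `natDegree_ΨSq_ne_zero_of_exists_torsion` (a non-zero `p`-torsion point makes `ψ_p²(V)`
  non-constant: *AEC* Ex. 3.7 + `#E[p+1] = (p+1)²`, III.6.4(b)) and
  `exists_torsion_of_natDegree_ΨSq_ne_zero` (converse: root + ordinate).
* §2 `natDegree_ΨSq_ne_zero_of_j_eq_of_not_dvd_trace` — **ordinarity is a property of `j` over `k̄`**:
  if an elliptic curve `E₁/𝔽_p` has trace of Frobenius prime to `p` (so `E₁(𝔽̄_p)` has a point of
  order `p`: *AEC* V.3.1(a) / Ex. V.5.10(a), the tree's `dvd_trace_of_forall_nsmul_ne_zero` with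
  `exists_frobenius_absoluteGaloisGroup`) and `j(V) = j(E₁)`, then `ψ_p²(V)` is non-constant
  (`E₁ ⊗ k ≅ V`, *AEC* III.1.4(b) = Mathlib `exists_variableChange_of_j_eq`);
  `natDegree_ΨSq_ne_zero_of_j_eq_zero` (`3 ∣ p − 1`) and `natDegree_ΨSq_ne_zero_of_j_eq_1728`
  (`4 ∣ p − 1`) from additive-p2's `SpecialJ.not_dvd_trace_of_j_eq_zero_of_card_eq` /
  `…_of_j_eq_of_card_eq` (Deuring; *AEC* V.4.1(a), Ex. V.4.4/V.4.5) applied to Mathlib's `ofJ`.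
* §3 `exists_torsion_goodReductionHom_ne_zero_of_natDegree_ΨSq_ne_zero` — **lifting**: for a
  unit-discriminant `M` over a valuation ring `O` of an algebraically closed `L`, a non-constant
  `ψ_p²(M̃)` gives an `O`-integral root of `ψ_p²(M)` (the tree's
  `exists_isRoot_of_natDegree_map_residue_ne_zero`), an integral point `(a, b)` over it, which is
  `p`-torsion and reduces to the AFFINE point `(ā, b̄) ≠ Õ` — the replay of the tree's
  `exists_zsmul_eq_zero_spectralValuation_le_one` (Serre 1972 §1.11) for an arbitrary good model;
  **`exists_torsion_goodReductionHom_ne_zero_of_residue_c₄_eq_zero`** (`j̃ = 0 ⟺ c̃₄ = 0`,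
  `3 ∣ p − 1`, `p ≥ 5`) and **`exists_torsion_goodReductionHom_ne_zero_of_residue_c₆_eq_zero`**
  (`j̃ = 1728 ⟺ c̃₆ = 0`, `4 ∣ p − 1`, `p ≥ 5`) — hypotheses instance-free (`residue c₄ = 0` /
  `residue c₆ = 0`), conclusion = the `hord` of `OrdinaryReductionKernelTorsionProofs` §5 VERBATIM.

Binder honesty: no class predicate, no curve over `ℚ`, no named fact; the residue characteristic
enters as `[CharP (IsLocalRing.ResidueField O) p]`. NOT claimed: the `e = 2` rows (any `j̃`; p10's
twist-model theorem), `p = 3` (where `3 ∣ e` is supersingular), `p = 2`.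

References: J. H. Silverman, *AEC* 2nd ed. III.1.4(b), III.6.4(b), Ex. 3.7, V.3.1(a), V.4.1(a),
Ex. V.4.4–4.5, Ex. V.5.10(a), VII.2.1 [SilvermanAEC2009]; J.-P. Serre, Invent. Math. 15 (1972)
§1.11 Prop. 11 [Serre1972]; M. Deuring, Abh. Math. Sem. Hamburg 14 (1941); cells/n1011/skel/T-ROL-G.md
(fa05b6d488a62a53); additive-p2 `Additive/SpecialJOrdinary.lean`, `SubGordHigherOrdinary.lean`.
-/

noncomputable section

open scoped Classical
open Polynomial WeierstrassCurve

universe u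

namespace Summit.BirchSwinnertonDyer.Rank1Residual.Additive.GoodModelLine

open Literature.NumberTheory.EllipticCurves

/-! ## §1 `p`-torsion and the `p`-division polynomial over an algebraically closed field of
characteristic `p` -/

section AlgClosed

variable {k : Type*} [Field k] [IsAlgClosed k] (V : WeierstrassCurve k) [V.IsElliptic]
  (p : ℕ) [hp : Fact p.Prime] [CharP k p]

/-- Over an algebraically closed field of characteristic `p`, a non-zero `p`-torsion point forces the
`p`-division polynomial `ψ_p²` to be NON-CONSTANT: its abscissa is a root (*AEC* Ex. 3.7), and
`ψ_p² ≠ 0` since otherwise every affine point would be `p`-torsion, including the `(p+1)²` points of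
`E[p+1]` (*AEC* III.6.4(b), the tree's `card_torsionBy_eq_sq`). (The argument of the tree's
`exists_zsmul_eq_zero_spectralValuation_le_one`, Step A, for a general curve.)
[cite: SilvermanAEC2009, Exercise 3.7 and Cor. III.6.4(b)] -/
theorem natDegree_ΨSq_ne_zero_of_exists_torsion
    (hQ : ∃ Q : V.toAffine.Point, Q ≠ 0 ∧ (p : ℤ) • Q = 0) : (V.ΨSq p).natDegree ≠ 0 := by
  obtain ⟨Q, hQ0, hpQ⟩ := hQ
  obtain ⟨u, hu⟩ : ∃ u, (V.ΨSq p).eval u = 0 := by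
    rcases Q with _ | ⟨u, w', huw⟩
    · exact absurd rfl hQ0
    · exact ⟨u, by rw [← zsmul_some_eq_zero_iff_eval_ΨSq V huw p]; exact hpQ⟩
  have hne : V.ΨSq p ≠ 0 := by
    intro h0
    have hp1 : ((p + 1 : ℕ) : k) ≠ 0 := by
      rw [Nat.cast_succ, CharP.cast_eq_zero k p, zero_add]
      exact one_ne_zero
    have hcard := card_torsionBy_eq_sq (E := V) hp1
    haveI : Finite (AddSubgroup.torsionBy V.toAffine.Point ((p + 1 : ℕ) : ℤ)) :=
      Nat.finite_of_card_ne_zero (by rw [hcard]; positivity)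
    have h1 : 1 < Nat.card (AddSubgroup.torsionBy V.toAffine.Point ((p + 1 : ℕ) : ℤ)) := by
      rw [hcard]
      nlinarith [hp.out.two_le]
    haveI := (Finite.one_lt_card_iff_nontrivial.mp h1)
    obtain ⟨⟨R, hR⟩, hR0⟩ :=
      exists_ne (0 : AddSubgroup.torsionBy V.toAffine.Point ((p + 1 : ℕ) : ℤ))
    have hR' : ((p + 1 : ℕ) : ℤ) • R = 0 := (Submodule.mem_torsionBy_iff _ _).mp hR
    rcases R with _ | ⟨u', w', h'⟩
    · exact hR0 (Subtype.ext rfl)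
    · have hpR : (p : ℤ) • (Affine.Point.some u' w' h' : V.toAffine.Point) = 0 := by
        rw [zsmul_some_eq_zero_iff_eval_ΨSq V h', h0, eval_zero]
      have h1R : (1 : ℤ) • (Affine.Point.some u' w' h' : V.toAffine.Point) = 0 := by
        rw [show (1 : ℤ) = ((p + 1 : ℕ) : ℤ) - p by push_cast; ring, sub_zsmul, hR', hpR]
        simp
      rw [one_zsmul] at h1R
      exact Affine.Point.some_ne_zero h' h1R
  intro h0
  rw [eq_C_of_natDegree_eq_zero h0, eval_C] at hu
  apply hne
  rw [eq_C_of_natDegree_eq_zero h0, hu, C_0]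

omit [CharP k p] hp in
/-- Conversely, over an algebraically closed field, a non-constant `ψ_p²` has a root `u`, over which
lies an affine point `(u, w)` (solve the monic quadratic), a non-zero `p`-torsion point.
[cite: SilvermanAEC2009, Exercise 3.7] -/
theorem exists_torsion_of_natDegree_ΨSq_ne_zero (hdeg : (V.ΨSq p).natDegree ≠ 0) :
    ∃ Q : V.toAffine.Point, Q ≠ 0 ∧ (p : ℤ) • Q = 0 := by
  have hdeg' : (V.ΨSq p).degree ≠ 0 := fun h ↦ hdeg (natDegree_eq_of_degree_eq_some h)
  obtain ⟨u, hu⟩ := IsAlgClosed.exists_root (V.ΨSq p) hdeg'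
  -- an ordinate over `u`
  set c₁ : k := V.a₁ * u + V.a₃ with hc₁
  set c₀ : k := u ^ 3 + V.a₂ * u ^ 2 + V.a₄ * u + V.a₆ with hc₀
  have hlt2 : (C c₁ * X - C c₀).degree < ((2 : ℕ) : WithBot ℕ) :=
    (degree_sub_le _ _).trans_lt
      (max_lt ((degree_C_mul_X_le _).trans_lt (by decide)) (degree_C_le.trans_lt (by decide)))
  have hlt : (C c₁ * X - C c₀).degree < (X ^ 2 : k[X]).degree := by rwa [degree_X_pow]
  have hqdeg : (X ^ 2 + (C c₁ * X - C c₀) : k[X]).degree ≠ 0 := by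
    rw [degree_add_eq_left_of_degree_lt hlt, degree_X_pow]
    decide
  obtain ⟨w, hw⟩ := IsAlgClosed.exists_root _ hqdeg
  have hroot : w ^ 2 + c₁ * w - c₀ = 0 := by
    have h := hw.eq_zero
    have : w ^ 2 + (c₁ * w - c₀) = 0 := by
      simpa only [eval_add, eval_sub, eval_pow, eval_mul, eval_X, eval_C] using h
    linear_combination this
  have heq : V.toAffine.Equation u w := by
    rw [Affine.equation_iff]
    rw [hc₁, hc₀] at hroot
    linear_combination hroot
  have hns : V.toAffine.Nonsingular u w := (Affine.equation_iff_nonsingular).mp heq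
  refine ⟨.some u w hns, Affine.Point.some_ne_zero hns, ?_⟩
  rw [zsmul_some_eq_zero_iff_eval_ΨSq V hns p]
  exact hu.eq_zero

end AlgClosed

/-! ## §2 Transfer from the prime field: `j(V) = j(E₁)` with `E₁/𝔽_p` ORDINARY makes `ψ_p²(V)`
non-constant -/

section Transfer

variable (p : ℕ) [hp : Fact p.Prime]

/-- **Ordinarity is a property of the `j`-invariant over an algebraically closed field.** Let
`E₁/𝔽_p` be an elliptic curve whose trace of Frobenius is prime to `p` (ORDINARY: `E₁(𝔽̄_p)` has a
point of order `p`, *AEC* V.3.1(a) / Ex. V.5.10(a), the tree's `dvd_trace_of_forall_nsmul_ne_zero`),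
`k` an algebraically closed field of characteristic `p`, and `V/k` an elliptic curve with
`j(V) = j(E₁)`. Then `ψ_p²(V)` is non-constant (`V(k)` has a point of order `p`): `E₁ ⊗ k ≅ V`
(*AEC* III.1.4(b), Mathlib `exists_variableChange_of_j_eq`), and `ψ_p²(E₁)` is non-constant with a
root in `k`. [cite: SilvermanAEC2009, Thm. V.3.1(a), Ex. V.5.10(a), Prop. III.1.4(b), Exercise 3.7] -/
theorem natDegree_ΨSq_ne_zero_of_j_eq_of_not_dvd_trace
    (E₁ : WeierstrassCurve (ZMod p)) [E₁.IsElliptic]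
    (hord : ¬ ((p : ℤ) ∣ (Nat.card (ZMod p) : ℤ) + 1 - Nat.card E₁.toAffine.Point))
    {k : Type*} [Field k] [IsAlgClosed k] [CharP k p] (V : WeierstrassCurve k) [V.IsElliptic]
    (hj : V.j = ZMod.castHom (dvd_refl p) k E₁.j) : (V.ΨSq p).natDegree ≠ 0 := by
  -- a point of order `p` on `E₁(𝔽̄_p)`
  obtain ⟨σ, hσ⟩ := WeierstrassCurve.exists_frobenius_absoluteGaloisGroup (ZMod p)
  have hT : ∃ Q : E₁.geomPoints, Q ≠ 0 ∧ (p : ℤ) • Q = 0 := by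
    by_contra hT
    push Not at hT
    exact hord (E₁.dvd_trace_of_forall_nsmul_ne_zero p hσ
      (fun Q hQ h ↦ hT Q hQ (by rw [natCast_zsmul]; exact h)))
  -- so `ψ_p²(E₁)` is non-constant
  haveI : CharP (AlgebraicClosure (ZMod p)) p :=
    (Algebra.charP_iff (ZMod p) (AlgebraicClosure (ZMod p)) p).mp inferInstance
  have h1 : ((E₁.baseChange (AlgebraicClosure (ZMod p))).ΨSq p).natDegree ≠ 0 :=
    natDegree_ΨSq_ne_zero_of_exists_torsion _ p hT
  have h1' : (E₁.ΨSq p).natDegree ≠ 0 := by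
    rwa [baseChange, map_ΨSq, natDegree_map_eq_of_injective (RingHom.injective _)] at h1
  -- transport `E₁` to `k` and compare with `V`
  set f : ZMod p →+* k := ZMod.castHom (dvd_refl p) k with hf
  have hjk : (E₁.map f).j = V.j := by rw [map_j, hj]
  obtain ⟨C, hC⟩ := exists_variableChange_of_j_eq (E₁.map f) V hjk
  have hdegk : ((E₁.map f).ΨSq p).natDegree ≠ 0 := by
    rw [map_ΨSq, natDegree_map_eq_of_injective f.injective]; exact h1'
  obtain ⟨Q, hQ0, hpQ⟩ := exists_torsion_of_natDegree_ΨSq_ne_zero (E₁.map f) p hdegk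
  -- the transported point on `V`
  refine natDegree_ΨSq_ne_zero_of_exists_torsion V p
    ⟨Affine.Point.congrEquiv hC (VariableChange.pointEquiv (E₁.map f) C Q), ?_, ?_⟩
  · intro h0
    apply hQ0
    apply (VariableChange.pointEquiv (E₁.map f) C).injective
    apply (Affine.Point.congrEquiv hC).injective
    rw [h0, map_zero, map_zero]
  · rw [← map_zsmul, ← map_zsmul, hpQ, map_zero, map_zero]

/-- The `j = 0` instance: for `p ≥ 5` with `3 ∣ p − 1`, every elliptic curve with `j = 0` over an
algebraically closed field of characteristic `p` has non-constant `ψ_p²` (the curve `ofJ 0` over `𝔽_p`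
is ORDINARY: additive-p2's `not_dvd_trace_of_j_eq_zero_of_card_eq`, Deuring / *AEC* Ex. V.4.4).
[cite: SilvermanAEC2009, Thm. V.4.1(a) and Exercise V.4.4] -/
theorem natDegree_ΨSq_ne_zero_of_j_eq_zero (hp5 : 5 ≤ p) (h3 : 3 ∣ p - 1)
    {k : Type*} [Field k] [IsAlgClosed k] [CharP k p] (V : WeierstrassCurve k) [V.IsElliptic]
    (hj : V.j = 0) : (V.ΨSq p).natDegree ≠ 0 := by
  have hord := SpecialJ.not_dvd_trace_of_j_eq_zero_of_card_eq (WeierstrassCurve.ofJ (0 : ZMod p)) hp.out hp5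
    (Nat.card_zmod p) (ofJ_j 0) h3
  exact natDegree_ΨSq_ne_zero_of_j_eq_of_not_dvd_trace p (WeierstrassCurve.ofJ (0 : ZMod p)) hord V
    (by rw [ofJ_j, map_zero, hj])

/-- The `j = 1728` instance: for `p ≥ 5` with `4 ∣ p − 1`, every elliptic curve with `j = 1728` over an
algebraically closed field of characteristic `p` has non-constant `ψ_p²` (the curve `ofJ 1728` over
`𝔽_p` is ORDINARY: additive-p2's `not_dvd_trace_of_j_eq_of_card_eq`, Deuring / *AEC* Ex. V.4.5).
[cite: SilvermanAEC2009, Thm. V.4.1(a) and Exercise V.4.5] -/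
theorem natDegree_ΨSq_ne_zero_of_j_eq_1728 (hp5 : 5 ≤ p) (h4 : 4 ∣ p - 1)
    {k : Type*} [Field k] [IsAlgClosed k] [CharP k p] (V : WeierstrassCurve k) [V.IsElliptic]
    (hj : V.j = 1728) : (V.ΨSq p).natDegree ≠ 0 := by
  have hord := SpecialJ.not_dvd_trace_of_j_eq_of_card_eq (WeierstrassCurve.ofJ (1728 : ZMod p)) hp.out hp5
    (Nat.card_zmod p) (ofJ_j 1728) h4
  exact natDegree_ΨSq_ne_zero_of_j_eq_of_not_dvd_trace p (WeierstrassCurve.ofJ (1728 : ZMod p)) hord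
    V (by rw [ofJ_j, map_ofNat, hj])

end Transfer

/-! ## §3 Lifting: a non-constant reduced `ψ_p²` gives an integral `p`-torsion point with non-zero
reduction (the ordinary hypothesis of `OrdinaryReductionKernelTorsionProofs` §5) -/

section Lift

variable {L : Type u} [Field L] [IsAlgClosed L] (O : ValuationSubring L)
  {Γ₀ : Type*} [LinearOrderedCommGroupWithZero Γ₀] {v : Valuation L Γ₀} (hv : v.Integers O)
  {M : WeierstrassCurve O} (hΔ : IsUnit M.Δ) (p : ℕ) [hp : Fact p.Prime]

omit hp in
include hv in
/-- **The ordinary point of a good model from its reduction.** For a Weierstrass equation `M` with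
unit discriminant over a valuation ring `O` of an algebraically closed field `L`, if the `p`-division
polynomial of the REDUCED curve `M̃ = M mod 𝔪` is non-constant, then some `p`-torsion point of
`M(L)` has non-zero reduction: an `O`-integral root `a` of `ψ_p²(M)` (the tree's
`exists_isRoot_of_natDegree_map_residue_ne_zero`, as `ψ_p²(M) mod 𝔪 = ψ_p²(M̃)`) carries an integral
point `(a, b)` (integral root of the monic quadratic), which is `p`-torsion (*AEC* Ex. 3.7) and
reduces to the AFFINE point `(ā, b̄) ≠ Õ`. This is the replay of the tree's
`exists_zsmul_eq_zero_spectralValuation_le_one` (Serre 1972 §1.11) for an ARBITRARY good model; its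
output is exactly the ordinary hypothesis `∃ P, p • P = 0 ∧ red P ≠ 0` of the tree's ordinary
filtration (`natCard_torsionBy_ker_goodReductionHom_eq` etc.).
[cite: SilvermanAEC2009, Prop. VII.2.1 and Exercise 3.7] [cite: Serre1972, §1.11 Prop. 11] -/
theorem exists_torsion_goodReductionHom_ne_zero_of_natDegree_ΨSq_ne_zero
    (hdeg : ((M.map (IsLocalRing.residue O)).ΨSq p).natDegree ≠ 0) :
    ∃ P : (M.baseChange L).toAffine.Point, (p : ℤ) • P = 0 ∧ goodReductionHom M hv hΔ P ≠ 0 := by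
  have hinj : Function.Injective (algebraMap O L) := hv.hom_inj
  haveI hM : M.IsElliptic := ⟨hΔ⟩
  haveI := isElliptic_map_residue (W := M) hΔ
  -- an integral root of `ψ_p²(M)`
  set F : O[X] := M.ΨSq p with hFdef
  have hFred : F.map (IsLocalRing.residue O) = (M.map (IsLocalRing.residue O)).ΨSq p := by
    rw [hFdef, ← map_ΨSq]
  have hdeg' : (F.map (IsLocalRing.residue O)).natDegree ≠ 0 := by rwa [hFred]
  obtain ⟨a, ha⟩ := exists_isRoot_of_natDegree_map_residue_ne_zero O F hdeg'
  -- an integral ordinate over `a`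
  set c₁ : O := M.a₁ * a + M.a₃ with hc₁
  set c₀ : O := a ^ 3 + M.a₂ * a ^ 2 + M.a₄ * a + M.a₆ with hc₀
  have hlt2 : (C c₁ * X - C c₀).degree < ((2 : ℕ) : WithBot ℕ) :=
    (degree_sub_le _ _).trans_lt
      (max_lt ((degree_C_mul_X_le _).trans_lt (by decide)) (degree_C_le.trans_lt (by decide)))
  have hqm : (X ^ 2 + (C c₁ * X - C c₀) : O[X]).Monic := monic_X_pow_add hlt2
  have hlt : (C c₁ * X - C c₀).degree < (X ^ 2 : O[X]).degree := by rwa [degree_X_pow]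
  have hqnat : (X ^ 2 + (C c₁ * X - C c₀) : O[X]).natDegree = 2 := by
    rw [natDegree_add_eq_left_of_degree_lt hlt, natDegree_X_pow]
  have hqdeg : ((X ^ 2 + (C c₁ * X - C c₀) : O[X]).map (IsLocalRing.residue O)).natDegree ≠ 0 := by
    rw [hqm.natDegree_map, hqnat]
    exact two_ne_zero
  obtain ⟨b, hb⟩ := exists_isRoot_of_natDegree_map_residue_ne_zero O _ hqdeg
  have hrootb : b ^ 2 + c₁ * b - c₀ = 0 := by
    have : b ^ 2 + (c₁ * b - c₀) = 0 := by
      have h := hb.eq_zero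
      simpa only [eval_add, eval_sub, eval_pow, eval_mul, eval_X, eval_C] using h
    linear_combination this
  have hab : b ^ 2 + (M.a₁ * a + M.a₃) * b = a ^ 3 + M.a₂ * a ^ 2 + M.a₄ * a + M.a₆ := by
    rw [hc₁, hc₀] at hrootb
    linear_combination hrootb
  -- the integral point `(a, b) ∈ M(L)[p]`
  have heqO : M.toAffine.Equation a b := by
    rw [Affine.equation_iff]
    linear_combination hab
  have hnsO : M.toAffine.Nonsingular a b := (Affine.equation_iff_nonsingular).mp heqO
  have hns : (M.baseChange L).toAffine.Nonsingular (algebraMap O L a) (algebraMap O L b) :=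
    (Affine.map_nonsingular _ hinj a b).mpr hnsO
  have hnsr : (M.map (IsLocalRing.residue O)).toAffine.Nonsingular (IsLocalRing.residue O a)
      (IsLocalRing.residue O b) :=
    (Affine.equation_iff_nonsingular).mp (heqO.map (IsLocalRing.residue O))
  refine ⟨.some _ _ hns, ?_, ?_⟩
  · rw [zsmul_some_eq_zero_iff_eval_ΨSq _ hns p, baseChange, map_ΨSq, eval_map, eval₂_at_apply,
      ← hFdef, ha.eq_zero, map_zero]
  · rw [goodReductionHom_apply, reducePoint_some_algebraMap hinj hns hnsr]
    exact Affine.Point.some_ne_zero hnsr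

include hv in
/-- **The ordinary point for `j̃ = 0`, `p ≡ 1 (mod 3)`, `p ≥ 5`**: a good model over a valuation ring
(residue characteristic `p`) of an algebraically closed field whose reduced curve has `j`-invariant
`0` carries a `p`-torsion point with non-zero reduction. (Semistability defects `e ∈ {3, 6}`:
Kodaira `IV, IV*, II, II*`.) [cite: SilvermanAEC2009, Thm. V.4.1(a), Exercise V.4.4, Prop. VII.2.1] -/
theorem exists_torsion_goodReductionHom_ne_zero_of_residue_c₄_eq_zero
    [CharP (IsLocalRing.ResidueField O) p] (hp5 : 5 ≤ p) (h3 : 3 ∣ p - 1)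
    (hc₄ : IsLocalRing.residue O M.c₄ = 0) :
    ∃ P : (M.baseChange L).toAffine.Point, (p : ℤ) • P = 0 ∧ goodReductionHom M hv hΔ P ≠ 0 := by
  haveI := isElliptic_map_residue (W := M) hΔ
  set kb := AlgebraicClosure (IsLocalRing.ResidueField O) with hkb
  haveI : CharP kb p :=
    (Algebra.charP_iff (IsLocalRing.ResidueField O) kb p).mp inferInstance
  have hj0 : (M.map (IsLocalRing.residue O)).j = 0 :=
    (M.map (IsLocalRing.residue O)).j_eq_zero (by rw [map_c₄, hc₄])
  have hj : ((M.map (IsLocalRing.residue O)).map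
      (algebraMap (IsLocalRing.ResidueField O) kb)).j = 0 := by
    rw [map_j, hj0, map_zero]
  have h1 := natDegree_ΨSq_ne_zero_of_j_eq_zero p hp5 h3 _ hj
  rw [map_ΨSq, natDegree_map_eq_of_injective (RingHom.injective _)] at h1
  exact exists_torsion_goodReductionHom_ne_zero_of_natDegree_ΨSq_ne_zero O hv hΔ p h1

include hv in
/-- **The ordinary point for `j̃ = 1728`, `p ≡ 1 (mod 4)`, `p ≥ 5`** (defect `e = 4`: Kodaira
`III, III*`). [cite: SilvermanAEC2009, Thm. V.4.1(a), Exercise V.4.5, Prop. VII.2.1] -/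
theorem exists_torsion_goodReductionHom_ne_zero_of_residue_c₆_eq_zero
    [CharP (IsLocalRing.ResidueField O) p] (hp5 : 5 ≤ p) (h4 : 4 ∣ p - 1)
    (hc₆ : IsLocalRing.residue O M.c₆ = 0) :
    ∃ P : (M.baseChange L).toAffine.Point, (p : ℤ) • P = 0 ∧ goodReductionHom M hv hΔ P ≠ 0 := by
  haveI := isElliptic_map_residue (W := M) hΔ
  set kb := AlgebraicClosure (IsLocalRing.ResidueField O) with hkb
  haveI : CharP kb p :=
    (Algebra.charP_iff (IsLocalRing.ResidueField O) kb p).mp inferInstance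
  have hj0 : (M.map (IsLocalRing.residue O)).j = 1728 :=
    (SpecialJ.j_eq_iff_c₆_eq_zero _).mpr (by rw [map_c₆, hc₆])
  have hj : ((M.map (IsLocalRing.residue O)).map
      (algebraMap (IsLocalRing.ResidueField O) kb)).j = 1728 := by
    rw [map_j, hj0, map_ofNat]
  have h1 := natDegree_ΨSq_ne_zero_of_j_eq_1728 p hp5 h4 _ hj
  rw [map_ΨSq, natDegree_map_eq_of_injective (RingHom.injective _)] at h1
  exact exists_torsion_goodReductionHom_ne_zero_of_natDegree_ΨSq_ne_zero O hv hΔ p h1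

end Lift

end Summit.BirchSwinnertonDyer.Rank1Residual.Additive.GoodModelLine

end
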